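import Summits.CriticalPhenomena.PercolationContinuityZ3.Theorems.PercNearOneGluingNoHeavyLowerTailSunflowerTBernPackStep
import HarnessLib

/-!
# `NoHeavyLowerTail` (crux stmt-CriticalPhenomena-4575), abstract sunflower cubic: T-BERN — the h-endgame condition (HC)
# for EVERY hub and EVERY tight pack (`hc_pack`)

Support file (seat `prim-ineq-prove-1` gen 64; `--supports stmt-CriticalPhenomena-4575`).  No `sorry`, no named facts.
Memo: run/shared/lean/prim/prim-ineq-prove-1/FINDING-PACK-prove1-g64.md §3–§4.

Setting of `…SunflowerTBernStarHC` / `…SunflowerTBernPackStep` (normalised coordinates, `0 ≤ κ ≤ λ ≤ 1`, `μ = 1−λ`,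
`γ_D = λD + μ`, `ᾱ = (1−κ) + K`, `μᾱ = (1−κ)γ_D`).  A HUB is a petal `(x_P, z_P, w_P)` (`1 ≤ w_P ≤ min(x_P, Dz_P)`,
`α_P = 1 + κ(x_P−1)`, `γ_P = λw_P + μz_P`); a TIGHT PACK is a finset of petals `(1+ξ_j, 1, 1+ξ_j)`, `0 ≤ ξ_j ≤ D−1`;
the x-budget is `κ·x_P·∏(1+ξ_j) ≤ K` (`= κX_T`).  After the exact absorption of the pack into the hub
(`zone_extend_exact`) the state is `G = γ_P·packG`, `A = packG·α_P − G·packS`, and the h-endgame ★ needs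
(`star_of_hc`, `gz = γ_D z_P`) the condition
  (HC)  `gz < G < A ⟹ μ(A − G)(G − gz) ≤ (ᾱ − A)(gz − μG)`,  i.e. `0 ≤ phiHC := ᾱ·gz − λ·gz·A − μG(ᾱ + gz − G)`.
**`hc_pack`** proves (HC) for every hub and every tight pack.  Reductions (each raises `A` at fixed `G`, and `phiHC` is
antitone in `A`, isotone in `gz`):
* `z_P = 1`, hub `u = γ_P ∈ [1, γ_D]` (`phiHC_z1_nonneg`, induction on the pack): pick a petal `x = 1+ξ_j`;
  if `uγ(x) ≤ γ_D` MERGE it into the hub (`x_P ↦ x_P x`, `u ↦ uγ(x)`; `A' − A = g_R ξ_j[μκ(x_P−1) + (p−μ)(u−1)] ≥ 0`,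
  `merge_A_le`) and recurse; otherwise TOP UP the hub to `w = D` with part of the petal (leftover `y`, `γ(y)γ_D = uγ(x)`,
  `x_P ↦ x_P x/y`; `yγ(y)(A' − A) = (x−y)g_R[μκ(x_P−y)γ(y) + (p−μ)(u−γ(y))y] ≥ 0`, `topup_A_le`) and conclude by the
  super-dwarf theorem `phiSD_nonneg` (bridge `phiHC_superdwarf`);
* `γ_P ≤ γ_D`: lower `gz` to `γ_D` (same `A, G`: a `z = 1` hub with `u = γ_P`);
* `γ_P > γ_D`: lower `gz` to `γ_P`, then `phiHC = γ_P·b(γ_P)` with `b` isotone and `γ_D·b(γ_D) ≥ 0` by the `u = γ_D` case.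
-/

noncomputable section

namespace Summit.CriticalPhenomena.PercolationContinuityZ3.Theorems.SunflowerPartition

namespace SafeCalc

namespace LinkedCurrency

open Finset

variable {ι : Type*}

/-! ## Elementary facts about `α(x) = 1 + κ(x−1)` and `γ(x) = 1 + λ(x−1)` -/

/-- `γ` is supermultiplicative: `γ(a)γ(b) ≤ γ(ab)` for `a, b ≥ 1`, `0 ≤ λ ≤ 1`. [this work] -/
theorem gamma_mul_le {lam a b : ℝ} (hl : 0 ≤ lam) (hl1 : lam ≤ 1) (ha : 1 ≤ a) (hb : 1 ≤ b) :
    (1 + lam * (a - 1)) * (1 + lam * (b - 1)) ≤ 1 + lam * (a * b - 1) := by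
  nlinarith [mul_nonneg (mul_nonneg hl (sub_nonneg.2 hl1)) (mul_nonneg (sub_nonneg.2 ha) (sub_nonneg.2 hb))]

/-- `α ≤ γ`: `1 + κ(x−1) ≤ 1 + λ(x−1)` for `κ ≤ λ`, `x ≥ 1`. [this work] -/
theorem alpha_le_gamma {κ lam x : ℝ} (hκl : κ ≤ lam) (hx : 1 ≤ x) : 1 + κ * (x - 1) ≤ 1 + lam * (x - 1) := by
  nlinarith [mul_nonneg (sub_nonneg.2 hκl) (sub_nonneg.2 hx)]

/-! ## The two comparison lemmas (merge, top-up) -/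

/-- **Merging a pack petal into the hub raises `A`.**  Hub `(x_P, u)`, petal `e` (`γ_e = 1+λe`, `d_e γ_e = (λ−κ)e`),
rest `(g_R, σ_R)`, `G = uγ_e g_R`:  `A' − A = g_R e[μκ(x_P − 1) + ((1−κ)−μ)(u − 1)]` where
`A = γ_e g_R α(x_P) − G(σ_R + d_e)`, `A' = g_R α(x_P(1+e)) − Gσ_R`. [this work] -/
theorem merge_A_eq {κ lam μ u xP e gR σR de : ℝ} (hμ : μ = 1 - lam) (hde : de * (1 + lam * e) = (lam - κ) * e) :
    (gR * (1 + κ * (xP * (1 + e) - 1)) - u * (1 + lam * e) * gR * σR) -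
        ((1 + lam * e) * gR * (1 + κ * (xP - 1)) - u * (1 + lam * e) * gR * (σR + de)) =
      gR * e * (μ * κ * (xP - 1) + ((1 - κ) - μ) * (u - 1)) := by
  subst hμ
  linear_combination (gR * u) * hde

/-- **Topping the hub up raises `A`.**  Hub `(x_P, u)`, petal `e` split into a leftover `y − 1` (`γ_y = 1 + λ(y−1)`,
`d_y γ_y = (λ−κ)(y−1)`) and a part moved to the hub (`x_P' y = x_P(1+e)`), `G = uγ_e g_R`:
`y γ_y (A' − A) = (1 + e − y) g_R [μκ(x_P − y)γ_y + ((1−κ)−μ)(u − γ_y) y]`. [this work] -/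
theorem topup_A_eq {κ lam μ u xP xP' e y γy gR σR de dy : ℝ} (hμ : μ = 1 - lam)
    (hde : de * (1 + lam * e) = (lam - κ) * e) (hdy : dy * γy = (lam - κ) * (y - 1))
    (hxP' : xP' * y = xP * (1 + e)) (hy : γy = 1 + lam * (y - 1)) :
    y * γy * ((γy * gR * (1 + κ * (xP' - 1)) - u * (1 + lam * e) * gR * (σR + dy)) -
        ((1 + lam * e) * gR * (1 + κ * (xP - 1)) - u * (1 + lam * e) * gR * (σR + de))) =
      (1 + e - y) * gR * (μ * κ * (xP - y) * γy + ((1 - κ) - μ) * (u - γy) * y) := by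
  subst hμ
  linear_combination (gR * γy * u * y) * hde + (-(gR * u * y * (1 + lam * e))) * hdy + (gR * γy ^ 2 * κ) * hxP' +
    (-(gR * (-(e * γy * κ * xP) + e * κ * u * y - e * lam * u * y - γy * κ * xP + γy * κ * y - γy * y))) * hy

/-! ## STEP 2: every `z = 1` hub -/

/-- **(HC) for every `z = 1` hub and every tight pack** (`gz = γ_D`).  Hub `(x_P, u)` with `1 ≤ u ≤ γ_D`,
`u ≤ γ(x_P)`; pack `W` with `0 ≤ ξ_j ≤ D−1`; x-budget `κ x_P ∏(1+ξ_j) ≤ K`; state `G = u·packG`,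
`A = packG·α(x_P) − G·packS`.  If `γ_D < G < A` then `0 ≤ phiHC λ μ ᾱ A G γ_D`. [this work] -/
theorem phiHC_z1_nonneg [DecidableEq ι] {κ lam μ D K abar : ℝ} (hκ0 : 0 ≤ κ) (hκl : κ ≤ lam) (hl1 : lam ≤ 1)
    (hμ : μ = 1 - lam) (hD : 1 ≤ D) (hK0 : 0 ≤ K) (habar : abar = (1 - κ) + K)
    (hI : μ * abar = (1 - κ) * (lam * D + μ)) :
    ∀ (n : ℕ) (W : Finset ι) (ξ : ι → ℝ) (xP u : ℝ), W.card = n → (∀ j ∈ W, 0 ≤ ξ j) → (∀ j ∈ W, ξ j ≤ D - 1) →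
      1 ≤ xP → 1 ≤ u → u ≤ lam * D + μ → u ≤ 1 + lam * (xP - 1) → κ * xP * ∏ j ∈ W, (1 + ξ j) ≤ K →
      lam * D + μ < u * packG lam W ξ →
      u * packG lam W ξ < packG lam W ξ * (1 + κ * (xP - 1)) - u * packG lam W ξ * packS κ lam W ξ →
      0 ≤ phiHC lam μ abar (packG lam W ξ * (1 + κ * (xP - 1)) - u * packG lam W ξ * packS κ lam W ξ)
        (u * packG lam W ξ) (lam * D + μ) := by
  have hl : 0 ≤ lam := hκ0.trans hκl
  have hμ0 : 0 ≤ μ := by rw [hμ]; linarith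
  have hp : 0 ≤ 1 - κ := by linarith
  have hpμ : μ ≤ 1 - κ := by rw [hμ]; linarith
  have hγD1 : 1 ≤ lam * D + μ := by rw [hμ]; nlinarith
  have hγD0 : 0 < lam * D + μ := by linarith
  intro n
  induction n with
  | zero =>
    intro W ξ xP u hcard _ _ _ _ huD _ _ hrel _
    rw [card_eq_zero.1 hcard] at hrel
    simp only [packG, prod_empty, mul_one] at hrel
    linarith
  | succ n ih =>
    intro W ξ xP u hcard hξ0 hξD hxP hu1 huD hux hbud hrelG hrelA
    obtain ⟨j, hj⟩ : W.Nonempty := by rw [← card_pos, hcard]; omega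
    -- names
    set R := W.erase j with hR
    set e := ξ j with he
    have he0 : 0 ≤ e := hξ0 j hj
    have heD : e ≤ D - 1 := hξD j hj
    have hRcard : R.card = n := by rw [hR, card_erase_of_mem hj, hcard]; rfl
    have hξ0R : ∀ i ∈ R, 0 ≤ ξ i := fun i hi => hξ0 i (mem_of_mem_erase hi)
    have hξDR : ∀ i ∈ R, ξ i ≤ D - 1 := fun i hi => hξD i (mem_of_mem_erase hi)
    set gR := packG lam R ξ with hgR
    set σR := packS κ lam R ξ with hσR
    set XR := ∏ i ∈ R, (1 + ξ i) with hXR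
    have hgR1 : 1 ≤ gR := one_le_packG hl R hξ0R
    have hσR0 : 0 ≤ σR := packS_nonneg hκl hl R hξ0R
    have hXR1 : 1 ≤ XR := Pendant.one_le_prod_of_one_le R fun i hi => by linarith [hξ0R i hi]
    have hγe : 0 < 1 + lam * e := by nlinarith [mul_nonneg hl he0]
    have hγe1 : 1 ≤ 1 + lam * e := by nlinarith [mul_nonneg hl he0]
    have hx1 : 1 ≤ 1 + e := by linarith
    -- the state, split at j
    have hG : packG lam W ξ = (1 + lam * e) * gR := packG_erase lam hj ξ
    have hS : packS κ lam W ξ = (lam - κ) * e / (1 + lam * e) + σR := packS_erase κ lam hj ξ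
    have hX : ∏ i ∈ W, (1 + ξ i) = (1 + e) * XR := prodX_erase hj ξ
    set de := (lam - κ) * e / (1 + lam * e) with hde
    have hde' : de * (1 + lam * e) = (lam - κ) * e := div_mul_cancel₀ _ hγe.ne'
    have hde0 : 0 ≤ de := div_nonneg (mul_nonneg (sub_nonneg.2 hκl) he0) hγe.le
    rw [hG, hS] at hrelA ⊢
    rw [hG] at hrelG
    rw [hX] at hbud
    -- A in the split form
    have hAeq : (1 + lam * e) * gR * (1 + κ * (xP - 1)) - u * ((1 + lam * e) * gR) * (de + σR) =
        (1 + lam * e) * gR * (1 + κ * (xP - 1)) - u * (1 + lam * e) * gR * (σR + de) := by ring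
    rw [hAeq] at hrelA ⊢
    have hGeq : u * ((1 + lam * e) * gR) = u * (1 + lam * e) * gR := by ring
    rw [hGeq] at hrelG hrelA ⊢
    set A := (1 + lam * e) * gR * (1 + κ * (xP - 1)) - u * (1 + lam * e) * gR * (σR + de) with hA
    set G := u * (1 + lam * e) * gR with hGdef
    by_cases hcase : u * (1 + lam * e) ≤ lam * D + μ
    · -- MERGE the petal into the hub: `x_P ↦ x_P(1+e)`, `u ↦ uγ_e`, pack `R`
      set A' := gR * (1 + κ * (xP * (1 + e) - 1)) - u * (1 + lam * e) * gR * σR with hA'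
      have hAA' : A ≤ A' := by
        have h := merge_A_eq (κ := κ) (u := u) (xP := xP) (gR := gR) (σR := σR) hμ hde'
        rw [← hA, ← hA'] at h
        have : 0 ≤ gR * e * (μ * κ * (xP - 1) + ((1 - κ) - μ) * (u - 1)) :=
          mul_nonneg (mul_nonneg (zero_le_one.trans hgR1) he0)
            (add_nonneg (mul_nonneg (mul_nonneg hμ0 hκ0) (sub_nonneg.2 hxP))
              (mul_nonneg (sub_nonneg.2 hpμ) (sub_nonneg.2 hu1)))
        linarith
      have hux' : u * (1 + lam * e) ≤ 1 + lam * (xP * (1 + e) - 1) := by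
        have h1 : u * (1 + lam * e) ≤ (1 + lam * (xP - 1)) * (1 + lam * ((1 + e) - 1)) := by
          rw [show (1 : ℝ) + e - 1 = e by ring]
          exact mul_le_mul_of_nonneg_right hux hγe.le
        exact h1.trans (gamma_mul_le hl hl1 hxP hx1)
      have hbud' : κ * (xP * (1 + e)) * XR ≤ K := by
        have : κ * (xP * (1 + e)) * XR = κ * xP * ((1 + e) * XR) := by ring
        rw [this]; exact hbud
      have hrelA' : G < A' := lt_of_lt_of_le hrelA hAA'
      have key := ih R ξ (xP * (1 + e)) (u * (1 + lam * e)) hRcard hξ0R hξDR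
        (one_le_mul_of_one_le_of_one_le hxP hx1) (one_le_mul_of_one_le_of_one_le hu1 hγe1) hcase hux'
        (by rw [← hXR]; exact hbud') (by rw [← hgR]; exact hrelG)
        (by rw [← hgR, ← hσR]; exact hrelA')
      rw [← hgR, ← hσR] at key
      have e1 : packG lam R ξ * (1 + κ * (xP * (1 + e) - 1)) - u * (1 + lam * e) * packG lam R ξ * packS κ lam R ξ =
          A' := by rw [hA', hgR, hσR]
      have e2 : u * (1 + lam * e) * packG lam R ξ = G := by rw [hGdef, hgR]
      rw [e1, e2] at key
      exact key.trans (phiHC_anti_A hl hγD0.le hAA')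
    · -- TOP UP the hub to `w = D` with part of the petal; the rest is a smaller petal `y − 1`
      push Not at hcase
      have hlpos : 0 < lam := by
        by_contra h
        have hl0 : lam = 0 := le_antisymm (not_lt.1 h) hl
        rw [hl0] at hcase huD; simp at hcase huD; linarith
      -- the leftover `y`: γ(y) γ_D = u γ_e
      set γy := u * (1 + lam * e) / (lam * D + μ) with hγy
      have hγyD : γy * (lam * D + μ) = u * (1 + lam * e) := div_mul_cancel₀ _ hγD0.ne'
      set y := 1 + (γy - 1) / lam with hydef
      have hy : γy = 1 + lam * (y - 1) := by rw [hydef]; field_simp; ring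
      have hγy1 : 1 ≤ γy := by rw [hγy, le_div_iff₀ hγD0]; linarith
      have hy1 : 1 ≤ y := by rw [hydef]; have := div_nonneg (sub_nonneg.2 hγy1) hlpos.le; linarith
      have hγyu : γy ≤ u := by
        -- ⟸ γ_e ≤ γ_D
        rw [hγy, div_le_iff₀ hγD0]
        have h1 : lam * e ≤ lam * (D - 1) := mul_le_mul_of_nonneg_left heD hl
        have h2 : 1 + lam * e ≤ lam * D + μ := by rw [hμ]; linarith
        exact mul_le_mul_of_nonneg_left h2 (by linarith)
      have hγye : γy ≤ 1 + lam * e := by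
        -- ⟸ u ≤ γ_D
        rw [hγy, div_le_iff₀ hγD0, mul_comm (1 + lam * e)]
        exact mul_le_mul_of_nonneg_right huD hγe.le
      have hyx : y ≤ 1 + e := by
        have h := le_of_mul_le_mul_left (show lam * (y - 1) ≤ lam * e by linarith) hlpos
        linarith
      have hyxP : y ≤ xP := by
        have h := le_of_mul_le_mul_left (show lam * (y - 1) ≤ lam * (xP - 1) by linarith) hlpos
        linarith
      have hy0 : 0 < y := by linarith
      have hγy0 : 0 < γy := by linarith
      -- new data
      set ξ' := Function.update ξ j (y - 1) with hξ'
      set xP' := xP * (1 + e) / y with hxP'def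
      have hxP' : xP' * y = xP * (1 + e) := div_mul_cancel₀ _ hy0.ne'
      have hg' : packG lam W ξ' = γy * gR := by rw [hξ', packG_update lam hj, ← hy]
      have hS' : packS κ lam W ξ' = (lam - κ) * (y - 1) / (1 + lam * (y - 1)) + σR := by
        rw [hξ', packS_update κ lam hj]
      have hT' : packT lam W ξ' * (y * XR) = γy * gR := by
        have h1 : ∏ i ∈ W, (1 + ξ' i) = y * XR := by
          rw [hξ', prodX_update hj]; ring
        rw [← h1, packT_mul_prodX lam W, hg']
        intro i hi
        rw [hξ']
        by_cases hij : i = j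
        · subst hij; rw [Function.update_self]; linarith
        · rw [Function.update_of_ne hij]; exact hξ0 i hi
      set dy := (lam - κ) * (y - 1) / (1 + lam * (y - 1)) with hdy
      rw [← hy] at hdy
      have hdy' : dy * γy = (lam - κ) * (y - 1) := by rw [hdy]; exact div_mul_cancel₀ _ hγy0.ne'
      have hdy0 : 0 ≤ dy := by
        rw [hdy]; exact div_nonneg (mul_nonneg (sub_nonneg.2 hκl) (by linarith)) hγy0.le
      -- the topped-up state has larger A
      set A' := γy * gR * (1 + κ * (xP' - 1)) - u * (1 + lam * e) * gR * (σR + dy) with hA'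
      have hAA' : A ≤ A' := by
        have h := topup_A_eq (κ := κ) (u := u) (gR := gR) (σR := σR) hμ hde' hdy' hxP' hy
        rw [← hA, ← hA'] at h
        have hpos : 0 ≤ (1 + e - y) * gR * (μ * κ * (xP - y) * γy + ((1 - κ) - μ) * (u - γy) * y) :=
          mul_nonneg (mul_nonneg (sub_nonneg.2 hyx) (zero_le_one.trans hgR1))
            (add_nonneg (mul_nonneg (mul_nonneg (mul_nonneg hμ0 hκ0) (sub_nonneg.2 hyxP)) hγy0.le)
              (mul_nonneg (mul_nonneg (sub_nonneg.2 hpμ) (sub_nonneg.2 hγyu)) hy0.le))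
        have hyy : 0 < y * γy := mul_pos hy0 hγy0
        by_contra hlt
        have : y * γy * (A' - A) < 0 := mul_neg_of_pos_of_neg hyy (by linarith)
        linarith
      -- the x-saturated super-dwarf state has still larger A, and its phiHC is phiSD ≥ 0
      set Asat := (1 - κ) * packG lam W ξ' + K * packT lam W ξ' -
        (lam * D + μ) * packG lam W ξ' * packS κ lam W ξ' with hAsat
      have hA'sat : A' ≤ Asat := by
        -- ⟸ γy gR κ xP' ≤ K Θ'  ⟸ (× yXR) κ xP' (y XR) ≤ K
        have hbud' : κ * xP' * (y * XR) ≤ K := by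
          have : κ * xP' * (y * XR) = κ * xP * ((1 + e) * XR) := by
            rw [show κ * xP' * (y * XR) = κ * (xP' * y) * XR by ring, hxP']; ring
          rw [this]; exact hbud
        have hyXR : 0 < y * XR := mul_pos hy0 (by linarith)
        have h1 : γy * gR * (κ * xP') * (y * XR) ≤ K * packT lam W ξ' * (y * XR) := by
          have lhs_eq : γy * gR * (κ * xP') * (y * XR) = γy * gR * (κ * xP * ((1 + e) * XR)) := by
            rw [show γy * gR * (κ * xP') * (y * XR) = γy * gR * κ * (xP' * y) * XR by ring, hxP']; ring
          have rhs_eq : K * packT lam W ξ' * (y * XR) = K * (γy * gR) := by rw [mul_assoc, hT']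
          rw [lhs_eq, rhs_eq]
          have h3 := mul_le_mul_of_nonneg_left hbud (mul_nonneg hγy0.le (zero_le_one.trans hgR1))
          linarith
        have h2 : γy * gR * (κ * xP') ≤ K * packT lam W ξ' := le_of_mul_le_mul_right h1 hyXR
        rw [hA', hAsat, hg', hS']
        have e3 : u * (1 + lam * e) * gR = (lam * D + μ) * (γy * gR) := by rw [← hγyD]; ring
        rw [e3]
        linarith
      have hSD := phiSD_nonneg hκ0 hκl hl1 hμ hD hK0 habar hI W (ξ := ξ')
        (fun i hi => by
          rw [hξ']
          by_cases hij : i = j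
          · subst hij; rw [Function.update_self]; linarith
          · rw [Function.update_of_ne hij]; exact hξ0 i hi)
        (fun i hi => by
          rw [hξ']
          by_cases hij : i = j
          · subst hij; rw [Function.update_self]; linarith
          · rw [Function.update_of_ne hij]; exact hξD i hi)
      rw [← phiHC_superdwarf hμ hI W ξ', ← hAsat, hg'] at hSD
      have hGeq' : (lam * D + μ) * (γy * gR) = G := by rw [hGdef, ← hγyD]; ring
      rw [hGeq'] at hSD
      exact (hSD.trans (phiHC_anti_A hl hγD0.le hA'sat)).trans (phiHC_anti_A hl hγD0.le hAA')

/-! ## STEP 3: every hub (`hc_pack`) -/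

/-- **(HC) FOR EVERY HUB AND EVERY TIGHT PACK.**  Normalised setting: `0 ≤ κ ≤ λ ≤ 1`, `μ = 1−λ`, `D ≥ 1`, `K ≥ 0`,
`ᾱ = (1−κ) + K`, `μᾱ = (1−κ)γ_D` (`γ_D = λD + μ`); hub `(x_P, z_P, w_P)` with `1 ≤ z_P`, `1 ≤ w_P ≤ x_P`, `w_P ≤ D z_P`,
`α_P = 1 + κ(x_P − 1)`, `γ_P = λw_P + μz_P`; tight pack `W`, `0 ≤ ξ_j ≤ D−1`, x-budget `κ x_P ∏(1+ξ_j) ≤ K`; exact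
state `G = γ_P·packG`, `A = packG·α_P − G·packS ≤ ᾱ`; `gz = γ_D z_P`.  Then
`gz < G → G < A → μ(A − G)(G − gz) ≤ (ᾱ − A)(gz − μG)` — the hypothesis `hHC` of `star_of_hc`. [this work] -/
theorem hc_pack [DecidableEq ι] {κ lam μ D K abar xP zP wP A G : ℝ} (hκ0 : 0 ≤ κ) (hκl : κ ≤ lam) (hl1 : lam ≤ 1)
    (hμ : μ = 1 - lam) (hD : 1 ≤ D) (hK0 : 0 ≤ K) (habar : abar = (1 - κ) + K)
    (hI : μ * abar = (1 - κ) * (lam * D + μ)) (W : Finset ι) {ξ : ι → ℝ} (hξ0 : ∀ j ∈ W, 0 ≤ ξ j)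
    (hξD : ∀ j ∈ W, ξ j ≤ D - 1) (hz : 1 ≤ zP) (hw1 : 1 ≤ wP) (hwx : wP ≤ xP) (hwD : wP ≤ D * zP)
    (hbud : κ * xP * ∏ j ∈ W, (1 + ξ j) ≤ K)
    (hG : G = (lam * wP + μ * zP) * packG lam W ξ)
    (hA : A = packG lam W ξ * (1 + κ * (xP - 1)) - G * packS κ lam W ξ) (hAabar : A ≤ abar) :
    (lam * D + μ) * zP < G → G < A →
      μ * (A - G) * (G - (lam * D + μ) * zP) ≤ (abar - A) * ((lam * D + μ) * zP - μ * G) := by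
  intro hrelG hrelA
  have hl : 0 ≤ lam := hκ0.trans hκl
  have hμ0 : 0 ≤ μ := by rw [hμ]; linarith
  have hxP : 1 ≤ xP := hw1.trans hwx
  have hγD1 : 1 ≤ lam * D + μ := by rw [hμ]; nlinarith
  have hγD0 : 0 < lam * D + μ := by linarith
  set γD := lam * D + μ with hγDdef
  set γP := lam * wP + μ * zP with hγP
  set g := packG lam W ξ with hg
  set σ := packS κ lam W ξ with hσ
  set αP := 1 + κ * (xP - 1) with hαP
  have hg1 : 1 ≤ g := one_le_packG hl W hξ0
  have hg0 : 0 < g := by linarith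
  have hσ0 : 0 ≤ σ := packS_nonneg hκl hl W hξ0
  have hγP1 : 1 ≤ γP := by
    have h1 : lam * 1 ≤ lam * wP := mul_le_mul_of_nonneg_left hw1 hl
    have h2 : μ * 1 ≤ μ * zP := mul_le_mul_of_nonneg_left hz hμ0
    rw [hγP, hμ] at *; linarith
  have hγP0 : 0 < γP := by linarith
  have hγPgz : γP ≤ γD * zP := by
    have h1 : lam * wP ≤ lam * (D * zP) := mul_le_mul_of_nonneg_left hwD hl
    rw [hγP, hγDdef]; linarith
  have hG0 : 0 ≤ G := by rw [hG]; exact mul_nonneg hγP0.le hg0.le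
  have hgzD : γD ≤ γD * zP := by nlinarith
  -- relevance ⟹ γ_P < α_P ≤ γ(x_P)
  have hA' : A ≤ g * αP := by rw [hA]; nlinarith [mul_nonneg hG0 hσ0]
  have hγα : γP < αP := by
    have h1 : γP * g < αP * g := by rw [hG] at hrelA; linarith
    exact lt_of_mul_lt_mul_right h1 hg0.le
  have hαγx : αP ≤ 1 + lam * (xP - 1) := alpha_le_gamma hκl hxP
  -- reduce to `0 ≤ phiHC … gz`
  rw [← sub_nonneg, phiHC_eq_hc hμ]
  have hmono : lam * A + μ * G ≤ abar := by
    have h1 : μ * G ≤ μ * A := mul_le_mul_of_nonneg_left hrelA.le hμ0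
    have h2 : lam * A + μ * A = A := by rw [hμ]; ring
    linarith
  -- the relevance hypotheses in Step-2 form
  have hrelA2 : γP * g < g * αP - γP * g * σ := by
    have h := hrelA
    rw [hA, hG] at h
    exact h
  by_cases hcase : γP ≤ γD
  · -- a `z = 1` hub with `u = γ_P`
    have hrelG2 : γD < γP * g := by rw [hG] at hrelG; exact lt_of_le_of_lt hgzD hrelG
    have key := phiHC_z1_nonneg hκ0 hκl hl1 hμ hD hK0 habar hI W.card W ξ xP γP rfl hξ0 hξD hxP hγP1 hcase
      (hγα.le.trans hαγx) hbud hrelG2 hrelA2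
    have e1 : packG lam W ξ * (1 + κ * (xP - 1)) - γP * packG lam W ξ * packS κ lam W ξ = A := by
      rw [hA, hG]
    have e2 : γP * packG lam W ξ = G := by rw [hG]
    rw [e1, e2] at key
    exact key.trans (phiHC_mono_gz hmono hgzD)
  · -- `γ_P > γ_D`: go through the super-dwarf `z = 1` hub `u = γ_D`
    push Not at hcase
    have hg1' : 1 < g := by
      -- γD zP < γP g ≤ γD zP g
      have h1 : γD * zP < γD * zP * g := by
        have h2 : γP * g ≤ γD * zP * g := mul_le_mul_of_nonneg_right hγPgz hg0.le
        rw [hG] at hrelG; linarith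
      have h3 : 0 < γD * zP := by nlinarith
      by_contra h
      push Not at h
      have : γD * zP * g ≤ γD * zP * 1 := mul_le_mul_of_nonneg_left h h3.le
      linarith
    have hG2 : γD < γD * g := by
      have := mul_lt_mul_of_pos_left hg1' hγD0
      rwa [mul_one] at this
    have hA2 : γD * g < g * αP - γD * g * σ := by
      -- γP(1+σ) < αP and γD < γP ⟹ γD(1+σ) < αP
      have h1 : γP * (1 + σ) * g < αP * g := by
        have e : γP * (1 + σ) * g = γP * g + γP * g * σ := by ring
        rw [e]; linarith
      have h2 : γP * (1 + σ) < αP := lt_of_mul_lt_mul_right h1 hg0.le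
      have h3 : γD * (1 + σ) < αP := lt_trans (mul_lt_mul_of_pos_right hcase (by linarith)) h2
      have h4 := mul_lt_mul_of_pos_right h3 hg0
      have e : γD * (1 + σ) * g = γD * g + γD * g * σ := by ring
      rw [e] at h4; linarith
    have key := phiHC_z1_nonneg hκ0 hκl hl1 hμ hD hK0 habar hI W.card W ξ xP γD rfl hξ0 hξD hxP hγD1 le_rfl
      ((hcase.le.trans hγα.le).trans hαγx) hbud hG2 hA2
    rw [← hg, ← hσ, ← hαP, phiHC_bform] at key
    have hbD : 0 ≤ abar * (1 - μ * g) - lam * g * αP + γD * g * (lam * σ + μ * (g - 1)) :=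
      nonneg_of_mul_nonneg_right key hγD0
    have hbP : 0 ≤ abar * (1 - μ * g) - lam * g * αP + γP * g * (lam * σ + μ * (g - 1)) := by
      have : 0 ≤ (γP - γD) * (g * (lam * σ + μ * (g - 1))) :=
        mul_nonneg (sub_nonneg.2 hcase.le) (mul_nonneg hg0.le
          (add_nonneg (mul_nonneg hl hσ0) (mul_nonneg hμ0 (sub_nonneg.2 hg1))))
      linarith
    have hP : 0 ≤ phiHC lam μ abar A G γP := by
      have e1 : A = g * αP - γP * g * σ := by rw [hA, hG]
      have e2 : G = γP * g := by rw [hG]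
      rw [e1, e2, phiHC_bform]
      exact mul_nonneg hγP0.le hbP
    exact hP.trans (phiHC_mono_gz hmono hγPgz)

end LinkedCurrency

end SafeCalc

end Summit.CriticalPhenomena.PercolationContinuityZ3.Theorems.SunflowerPartition
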